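import Summits.HodgeConjecture.HodgeConjecture.Theorems.LimitExtensionMidFixedPartOnPuncturedCurve
import HarnessLib

/-!
# Crux `LimitExtensionFour` (stmt-HodgeConjecture-2996) — stub `stub_hodgeTypePropagates`, granted Charles–Schnell Prop. 11.3.5 (1)

Route `LimitExtension`, crux `Theses.LimitExtension.LimitExtensionFour` (the fourfold case of the limit
extension mechanism), registered skeleton `Cruxes/LimitExtensionFour/Lines/birth.lean`. Its stub
`stub_hodgeTypePropagates` is the theorem of the fixed part on the punctured curve of a flat proper
degeneration `f : W ⟶ T` whose fibres off `t₀` are smooth projective FOURFOLDS: for a rational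
`B ∈ H⁴(W(ℂ); ℂ)`, if `B|_{W_{t₁}}` is of type `(2,2)` for one `t₁ ≠ t₀` then `B|_{W_t}` is of type `(2,2)`
for every `t ≠ t₀`. It is registered UNCONDITIONALLY; its content is Charles–Schnell Prop. 11.3.5 (1) /
Deligne's (4.1.3.1), which the tree holds only as the named fact `HodgeTheory.charlesSchnell_hodgeClass_of_flat`
(discharged for quasi-projective and for projective total spaces, not for the proper families of the stub).
The sister crux `LimitExtensionMid` registered the same content SPLIT as F0 (the named fact) + F1
(`charlesSchnell_hodgeClass_of_flat → FixedPartOnPuncturedCurve`, landed: `Theorems.stub_fixedPartOnPuncturedCurve`,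
p246455). This file lands the fourfold twin in the same conditional shape:

* `hodgeTypePropagatesFour_of_charlesSchnell : charlesSchnell_hodgeClass_of_flat → (body of stub_hodgeTypePropagates)`,
  VERBATIM the registered signature behind the one named fact — the proof of
  `Theorems.fixedPartOnPuncturedCurve_of_charlesSchnell` with the good fibres smooth projective fourfolds
  instead of hypersurfaces (good affine pieces of the punctured curve over which `f` is a smooth projective
  family, `Theorems.exists_isAffineOpen_isSmoothProjectiveFamily`; two steps of
  `Theorems.isOfHodgeType_map_fiberι_of_charlesSchnell_of_affineOpen` through a common closed point).

For the lead of line `birth` of `LimitExtensionFour`: reshape `stub_hodgeTypePropagates := charlesSchnell_hodgeClass_of_flat → …`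
(as `LimitExtensionMid` did) and close it by this theorem; the named fact is then the crux's one C-row on this
stub. No `sorry`, no new definition, no new named fact.

References: [CharlesSchnell2014Notes] F. Charles, C. Schnell, Notes on absolute Hodge classes (2014),
Prop. 11.3.5 (1); [DeligneHodgeII1971] P. Deligne, Théorie de Hodge II, Publ. Math. IHÉS 40 (1971), Thm. 4.1.1,
Cor. 4.1.2, (4.1.3.1).
-/

-- `Summit.<Summit>.<Problem>`: for the single-conjunct summit `HodgeConjecture` the duplicate component is mandated.
set_option linter.dupNamespace false

noncomputable section

open CategoryTheory AlgebraicGeometry Topology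
open Literature.AlgebraicGeometry Literature.AlgebraicGeometry.Motives Literature.AlgebraicGeometry.HodgeTheory

namespace Summit.HodgeConjecture.HodgeConjecture.Theorems

/-- **The theorem of the fixed part on the punctured curve, smooth projective fibres of any dimension,
granted Charles–Schnell Prop. 11.3.5 (1).** Let `T` be a smooth irreducible `ℂ`-scheme of relative
dimension one, `f : W ⟶ T` flat and proper, `t₀ ∈ T(ℂ)`, such that every fibre `W_t`, `t ≠ t₀`, is a smooth
projective variety of dimension `n`, and `B ∈ H²ᵖ(W(ℂ); ℂ)` a rational class. Granted
`charlesSchnell_hodgeClass_of_flat`, if `B|_{W_{t₁}}` is of type `(p,p)` for one `t₁ ≠ t₀` then `B|_{W_t}` is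
of type `(p,p)` for every `t ≠ t₀`. (The proof of `fixedPartOnPuncturedCurve_of_charlesSchnell`, which uses
its hypersurface hypothesis only through the smooth projectivity of the good fibres.)
[cite: CharlesSchnell2014Notes, Prop. 11.3.5 (1)] [cite: DeligneHodgeII1971, (4.1.3.1)] -/
theorem isOfHodgeType_map_fiberι_puncturedCurve_of_charlesSchnell (hCS : charlesSchnell_hodgeClass_of_flat)
    {n p : ℕ} ⦃T W : SchemeOver ℂ⦄ (f : W ⟶ T) (t₀ : ComplexPoints T) (B : complexBetti W (2 * p))
    (hT : SmoothOfRelativeDimension 1 T.hom) (hirr : IrreducibleSpace T.left) (hfl : Flat f.left)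
    (hpr : IsProper f.left) (hB : IsRationalClass B)
    (hsm : ∀ t : ComplexPoints T, t ≠ t₀ → IsSmoothProjective n (fiberOver f t))
    (t₁ : ComplexPoints T) (ht₁ : t₁ ≠ t₀)
    (hH₁ : IsOfHodgeType n (fiberOver f t₁) (2 * p) p p (complexBetti.map (fiberι f t₁) (2 * p) B))
    (t : ComplexPoints T) (ht : t ≠ t₀) :
    IsOfHodgeType n (fiberOver f t) (2 * p) p p (complexBetti.map (fiberι f t) (2 * p) B) := by
  -- adapted from `Theorems.fixedPartOnPuncturedCurve_of_charlesSchnell` (gen 28, crux `LimitExtensionMid`)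
  haveI := hT
  haveI := hirr
  haveI := hfl
  haveI := hpr
  haveI : Smooth T.hom := SmoothOfRelativeDimension.smooth 1 T.hom
  haveI : LocallyOfFiniteType T.hom := inferInstance
  haveI : JacobsonSpace T.left := LocallyOfFiniteType.jacobsonSpace T.hom
  -- the punctured curve `O = T ∖ {pt t₀}` and its good fibres
  set O : T.left.Opens := ⟨{t₀.pt}ᶜ, (ComplexPoints.isClosed_pt t₀).isOpen_compl⟩ with hO
  have hmemO : ∀ b : ComplexPoints T, b ≠ t₀ → b.pt ∈ O :=
    fun b hb h => hb (complexPoints_eq_of_pt_eq h)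
  have hgood : ∀ b : ComplexPoints T, b.pt ∈ O → IsSmoothProjective n (fiberOver f b) := by
    intro b hb
    have hne : b ≠ t₀ := by
      rintro rfl
      exact hb rfl
    exact hsm b hne
  -- good affine pieces around `t₁` and `t`
  obtain ⟨V₁, hV₁, h₁V₁, -, hfam₁⟩ :=
    exists_isAffineOpen_isSmoothProjectiveFamily f O hgood t₁ (hmemO t₁ ht₁)
  obtain ⟨V₂, hV₂, h₂V₂, -, hfam₂⟩ :=
    exists_isAffineOpen_isSmoothProjectiveFamily f O hgood t (hmemO t ht)
  -- they meet in a closed point, which underlies a complex point `u`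
  have hne : ((V₁ : Set T.left) ∩ (V₂ : Set T.left)).Nonempty := by
    obtain ⟨x, -, hx⟩ := (PreirreducibleSpace.isPreirreducible_univ (X := T.left)) _ _ V₁.isOpen
      V₂.isOpen ⟨t₁.pt, Set.mem_univ _, h₁V₁⟩ ⟨t.pt, Set.mem_univ _, h₂V₂⟩
    exact ⟨x, hx⟩
  obtain ⟨y, ⟨hy₁, hy₂⟩, hyc⟩ :=
    nonempty_inter_closedPoints hne (V₁.isOpen.inter V₂.isOpen).isLocallyClosed
  obtain ⟨u, rfl⟩ := exists_complexPoints_pt_eq hyc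
  -- `t₁ → u` inside `V₁`, then `u → t` inside `V₂`
  exact isOfHodgeType_map_fiberι_of_charlesSchnell_of_affineOpen f hCS B hB V₂ hV₂ hfam₂ hy₂ h₂V₂
    (isOfHodgeType_map_fiberι_of_charlesSchnell_of_affineOpen f hCS B hB V₁ hV₁ hfam₁ h₁V₁ hy₁ hH₁)

/-- **Stub `stub_hodgeTypePropagates` of crux `LimitExtensionFour` (stmt-HodgeConjecture-2996), line
`birth`, behind Charles–Schnell Prop. 11.3.5 (1)**: `charlesSchnell_hodgeClass_of_flat →` (the registered
signature VERBATIM) — for a flat proper `f : W ⟶ T` over a smooth irreducible curve whose fibres off `t₀`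
are smooth projective fourfolds and a rational `B ∈ H⁴(W(ℂ); ℂ)`, the Hodge type `(2,2)` of `B|_{W_t}`
propagates from one `t₁ ≠ t₀` to every `t ≠ t₀`. The fourfold twin of `Theorems.stub_fixedPartOnPuncturedCurve`
(crux `LimitExtensionMid`, stub F1). [cite: CharlesSchnell2014Notes, Prop. 11.3.5 (1)]
[cite: DeligneHodgeII1971, Thm. 4.1.1, Cor. 4.1.2] -/
theorem hodgeTypePropagatesFour_of_charlesSchnell :
    charlesSchnell_hodgeClass_of_flat →
    ∀ ⦃T W : SchemeOver ℂ⦄ (f : W ⟶ T) (t₀ : ComplexPoints T) (B : complexBetti W 4),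
      AlgebraicGeometry.SmoothOfRelativeDimension 1 T.hom → IrreducibleSpace T.left →
      AlgebraicGeometry.Flat f.left → AlgebraicGeometry.IsProper f.left →
      (∀ t : ComplexPoints T, t ≠ t₀ → IsSmoothProjective 4 (fiberOver f t)) → IsRationalClass B →
      ∀ t₁ : ComplexPoints T, t₁ ≠ t₀ →
        IsOfHodgeType 4 (fiberOver f t₁) 4 2 2 (complexBetti.map (fiberι f t₁) 4 B) →
        ∀ t : ComplexPoints T, t ≠ t₀ →
          IsOfHodgeType 4 (fiberOver f t) 4 2 2 (complexBetti.map (fiberι f t) 4 B) :=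
  fun hCS _ _ f t₀ B hT hirr hfl hpr hsm hB t₁ ht₁ hH₁ t ht =>
    isOfHodgeType_map_fiberι_puncturedCurve_of_charlesSchnell hCS (n := 4) (p := 2) f t₀ B hT hirr hfl
      hpr hB hsm t₁ ht₁ hH₁ t ht

end Summit.HodgeConjecture.HodgeConjecture.Theorems

end
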